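import Summits.HodgeConjecture.HodgeConjecture.Theorems.HCCMUnconditionalH413OfF0       -- ★ p816533 (F2) `HCCMUnconditionalH413OfF0.H413_of_F0HdictE_F0HJ3a : F0HdictE → F0HJ3a → H413` (F0P4-p07 (g5); socket 27457 discharged by ★ `F0Hocc_holds`)
import Summits.HodgeConjecture.HodgeConjecture.Theorems.HCCMUnconditionalHLiu418OfH415   -- ★ `CorCM.HypLiu418.HLiu418_of_h415 (h415 : Thm415AtFace) (h21) (h413) : HLiu418` (floor «Fal OUT», T5′; HD3 ∕ (Lp) ∕ III-11 closed inside)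
import Summits.HodgeConjecture.HodgeConjecture.Theorems.HCCMUnconditionalHDelOfF0        -- ★ p807981 `HCCMUnconditionalHDelOfF0.HDel_holds` (item 24835 CLOSED; Siegel fine moduli scheme from the four ★ cores)
import Summits.HodgeConjecture.HodgeConjecture.Theorems.HCCMUnconditionalH21             -- ★ `Theorems.H21_proof` (item 24834 CLOSED)
import Summits.HodgeConjecture.HodgeConjecture.Theorems.HCCMUnconditionalH411            -- ★ `Theorems.H411_proof` (item 24836 CLOSED)
import Summits.HodgeConjecture.HodgeConjecture.Theorems.HCCMUnconditionalHD1pp           -- ★ `Theorems.HD1pp_proof` (item 24838 CLOSED)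
import HarnessLib

/-!
# FLOOR EDITION v8 «THREE SOCKETS» — rung 0 from EXACTLY the three OPEN route items `F0HdictE` (27455) · `F0HJ3a` (27456) · `F0H415` (27458), by item NAME

Summit `HodgeConjecture`, sub-problem `HodgeConjecture`, route `HCCMUnconditional` (rung HODGECM-MATHLIB-0, deciding theorem
`Theses.HCCMUnconditional.closes : HDel → H21 → HLiu418 → H413 → H411 → HD3 → HD1pp → RankFourFaces.CMAbelianHodge`).  Cell `hodgecm-mathlib`,
programme HC_CM FLOOR 0 (D-0183).  PROVER FILE, THEOREMS ONLY (A-p17 (g15), 2026-08-31).  HONEST LABEL: HC_CM is proved only modulo the 7 printed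
citations until rung 0 closes; THIS file adds no mathematics — it is a STATUS ∕ CENSUS theorem, the successor of ★ `hc_cm_of_generic_floor_v7`
(`HCCMUnconditionalOfGenericFloorV7.lean`, FIVE generic inputs {(F), dictE, J3a, occ, 415} typed as Literature-level ∀-closures) now that two of
the five floor-0 sockets are THEOREMS: (F) = item 27454 `F0HF` (★ `F0HF_holds` ∕ `HDel_holds`, programme P1) and III-2 (c)′ = item 27457 `F0Hocc`
(★ `HCCMUnconditionalF0HoccOfP4.F0Hocc_holds`, programme P4).

WHAT IT SAYS.  With every binder typed as a ROUTE DECL BY NAME (`Theses.HCCMUnconditional.F0HdictE` ∕ `.F0HJ3a` ∕ `.F0H415` — the `def`s unfold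
definitionally to the Theses-free socket types ★ `F0FloorSockets.{HdictEType, HJ3aType, H415Type}`, and `H415Type` is the body of ★
`CorCM.Lines.A3Liu418.Thm415AtFace` byte for byte):

* `HLiu418_of_F0H415_H413 (h₁ : F0H415) (h₂ : H413) : HLiu418` — item 24832 modulo socket 27458 and item 24833: ★ `HLiu418_of_h415` with
  `h21 := H21_proof`; the two `def` unfoldings `F0H415 → H415Type → ‹body of Thm415AtFace›` by `delta` (zero mathematics);
* `HLiu418_of_F0_sockets (h₁ : F0H415) (h₂ : F0HdictE) (h₃ : F0HJ3a) : HLiu418` — the same with `H413` discharged through ★ (F2)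
  `H413_of_F0HdictE_F0HJ3a` (so 24832 ⇐ {27458, 27455, 27456});
* **`cmAbelianHodge_of_F0_sockets (h₁ : F0HdictE) (h₂ : F0HJ3a) (h₃ : F0H415) : RankFourFaces.CMAbelianHodge`** — RUNG 0 ⇐ EXACTLY the three
  open items, kernel-checked: `Theses.HCCMUnconditional.closes HDel_holds H21_proof ‹HLiu418› ‹H413› H411_proof HD3_proof HD1pp_proof`.

DAY-X (not in this file): `theorem cmAbelianHodge_holds : RankFourFaces.CMAbelianHodge := cmAbelianHodge_of_F0_sockets F0HdictE_holds F0HJ3a_holds F0H415_holds`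
the day the P2 closer of 27455 (`Cruxes/H413/Lines/F0_P2CohFinComponentIsThetaC.lean`: `stub_PK_localThetaClasses` ⟸ PKΠ ★-vehicle `F0P2gPKOfRung3.stubPK_of_PKPi`,
`stub_E3flat_automorphicParity`), the P3 closer of 27456 (`F0_U3LettersRung1.lean`: `stub_E1` ∕ `stub_S2` ∕ `stub_R`, ENGINE T1) and the P5 closer of 27458
(`Cruxes/HLiu418/Lines/F0_AlbCm.lean`: `stub_S1_facts` ∕ `stub_S1b_facts` ∕ `stub_D9op`, P6 boundary `stub_MOD`) are ★; the items themselves close by their own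
`--workitem` files, this census theorem only records that nothing ELSE is owed.

No `def`, no `sorry`, no `Cruxes/…/Lines` import; axioms of every theorem = {propext, Classical.choice, Quot.sound}.

## References
[Liu2021] Y. Liu, Thm. 1.1 (CM case), Thm. 4.18, Prop. 4.13 (proof l. 2110–2146), Thm. 4.15, Def. 4.11 · [Deligne1979ShimuraVarieties] 2.2.5, Cor. 2.7.21 ·
[MumfordFogartyKirwan1994] Thm. 7.9 · [Lan2013PELCompactifications] Thm. 1.4.1.11, Cor. 7.2.3.9 · [Rogawski1990] Thm. 13.3.1 · [GelbartRogawski1991] Thm. 5.1.1 ·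
[Li1992] Thm. 2.1 · [Shimura1998] Thm. 21.4.
-/

set_option autoImplicit false
-- the mandated namespace has the single-problem summit's repeated segment (`HodgeConjecture.HodgeConjecture`)
set_option linter.dupNamespace false

namespace Summit.HodgeConjecture.HodgeConjecture.Theorems.HCCMUnconditionalOfF0Sockets

open Summit.HodgeConjecture.HodgeConjecture.Theses (HCCMUnconditional.HDel HCCMUnconditional.H21 HCCMUnconditional.HLiu418 HCCMUnconditional.H413
  HCCMUnconditional.H411 HCCMUnconditional.HD3 HCCMUnconditional.HD1pp HCCMUnconditional.F0HdictE HCCMUnconditional.F0HJ3a HCCMUnconditional.F0H415)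

set_option synthInstance.maxHeartbeats 400000 in
set_option maxHeartbeats 8000000 in
/-- **Item 24832 `HLiu418` modulo socket 27458 `F0H415` and item 24833 `H413`** — ★ `CorCM.HypLiu418.HLiu418_of_h415` ([Liu2021, Thm. 4.18] from
Thm. 4.15 at the face, the T5′ CM-type lever replacing [Faltings1983], ε-rigidity III-11 ★, (Lp) ★, `HD3_proof` ★) with `h21 := H21_proof` ★ and the binder
`h415` read at the ROUTE decl `F0H415` (`:= F0FloorSockets.H415Type`, whose body is `Thm415AtFace`'s byte for byte; two `delta` unfoldings).
[cite: Liu2021, Thm. 4.18 proof (FJcycle.tex l. 2235–2290); Thm. 4.15] [cite: MurtyRamakrishnan1992, Prop. 6] -/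
theorem HLiu418_of_F0H415_H413 (h₁ : HCCMUnconditional.F0H415) (h₂ : HCCMUnconditional.H413) : HCCMUnconditional.HLiu418 :=
  Summit.HodgeConjecture.CorCM.HypLiu418.HLiu418_of_h415
    (by
      delta Summit.HodgeConjecture.HodgeConjecture.Theses.HCCMUnconditional.F0H415
        Summit.HodgeConjecture.HodgeConjecture.Theorems.F0FloorSockets.H415Type at h₁
      exact h₁)
    Summit.HodgeConjecture.HodgeConjecture.Theorems.H21_proof h₂

set_option synthInstance.maxHeartbeats 400000 in
set_option maxHeartbeats 8000000 in
/-- **Item 24832 `HLiu418` modulo the three open sockets** `F0H415` (27458, P5), `F0HdictE` (27455, P2), `F0HJ3a` (27456, P3): the previous theorem with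
`H413` discharged through ★ (F2) `HCCMUnconditionalH413OfF0.H413_of_F0HdictE_F0HJ3a` (socket 27457 `F0Hocc` ★ inside).
[cite: Liu2021, Thm. 4.18; Prop. 4.13 proof l. 2145] [cite: Li1992, Thm 2.1] -/
theorem HLiu418_of_F0_sockets (h₁ : HCCMUnconditional.F0H415) (h₂ : HCCMUnconditional.F0HdictE) (h₃ : HCCMUnconditional.F0HJ3a) :
    HCCMUnconditional.HLiu418 :=
  HLiu418_of_F0H415_H413 h₁ (HCCMUnconditionalH413OfF0.H413_of_F0HdictE_F0HJ3a h₂ h₃)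

set_option synthInstance.maxHeartbeats 400000 in
set_option maxHeartbeats 8000000 in
/-- **FLOOR v8 «THREE SOCKETS» — rung 0 (`RankFourFaces.CMAbelianHodge` = HC_CM) from EXACTLY the three open route items `F0HdictE` (27455),
`F0HJ3a` (27456), `F0H415` (27458), BY NAME.**  Term: the route's deciding theorem `Theses.HCCMUnconditional.closes` fed `HDel_holds` ★ (24835),
`H21_proof` ★ (24834), `HLiu418_of_F0_sockets h₃ h₁ h₂`, ★ (F2) `H413_of_F0HdictE_F0HJ3a h₁ h₂`, `H411_proof` ★ (24836), `HD3_proof` ★ (24837),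
`HD1pp_proof` ★ (24838).  A STATUS theorem (successor of ★ `hc_cm_of_generic_floor_v7`, five inputs): HC_CM is proved only modulo the 7 printed citations
until rung 0 closes; modulo Mathlib + the ★ tree, what is owed is exactly these three hypotheses.
[cite: Liu2021, Thm. 1.1 (CM case); Thm. 4.18; Prop. 4.13; Thm. 4.15] [cite: Deligne1979ShimuraVarieties, 2.2.5 and Cor. 2.7.21]
[cite: MumfordFogartyKirwan1994, Thm. 7.9] [cite: Rogawski1990, Thm. 13.3.1] [cite: GelbartRogawski1991, Thm. 5.1.1] [cite: Shimura1998, Thm. 21.4] -/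
theorem cmAbelianHodge_of_F0_sockets (h₁ : HCCMUnconditional.F0HdictE) (h₂ : HCCMUnconditional.F0HJ3a) (h₃ : HCCMUnconditional.F0H415) :
    Summit.HodgeConjecture.HodgeConjecture.Theses.RankFourFaces.CMAbelianHodge :=
  have h413 : HCCMUnconditional.H413 := HCCMUnconditionalH413OfF0.H413_of_F0HdictE_F0HJ3a h₁ h₂
  Summit.HodgeConjecture.HodgeConjecture.Theses.HCCMUnconditional.closes HCCMUnconditionalHDelOfF0.HDel_holds
    Summit.HodgeConjecture.HodgeConjecture.Theorems.H21_proof (HLiu418_of_F0H415_H413 h₃ h413) h413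
    Summit.HodgeConjecture.HodgeConjecture.Theorems.H411_proof Summit.HodgeConjecture.HodgeConjecture.Theorems.HD3_proof
    Summit.HodgeConjecture.HodgeConjecture.Theorems.HD1pp_proof

end Summit.HodgeConjecture.HodgeConjecture.Theorems.HCCMUnconditionalOfF0Sockets
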